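import Summits.NavierStokesRegularity.FluidComputer.LevelFluxFloor
import Literature.Analysis.FluidPDE.ConstantinDirectionDissipationProofs
import Literature.Analysis.FluidPDE.LerayHopfRestartEverywhere
import HarnessLib

/-!
# Fluid computer — L17: the BAND-FLUX CEILING and the BACKSCATTER FLOOR (companions of the flux floors L16/L16′)

HONEST FRAMING (cell `pub-fluidc`, verbatim): *low prior, high value-of-information experiment on Tao's
machine paradigm; NOT a claim that NS blows up.* Theorem side of the cell (necessities / ceilings every cascade
design must respect); nothing here is evidence of blow-up, and nothing is said about any fixed finite set of levels.

The flux face of the level dictionary (`LevelFluxFloor.band_flux_ge` L16, `ForwardFluxFloor.forward_flux_floor` L16′)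
bounds the windowed band flux `∫_s^t Π_B(u) dτ = −∑_{j∈B} ∫_s^t N_j(u(τ)) dτ` (`N_j(w) = ∫⟪Δ̇_j w, Δ̇_j((w·∇)w)⟫`) of a
maximal smooth Leray–Hopf solution from BELOW. This file adds the matching CEILING (uniform in the band and the window)
and its signed companion, the BACKSCATTER FLOOR (no inverse cascade out of a band beyond its initial stock):

* `neg_integral_transfer_eq` — the signed balance solved for the feeding: `−∫_s^t N_j = ½(‖Δ̇_j u(t)‖₂² − ‖Δ̇_j u(s)‖₂²)
  + ν ∫_s^t S_j`, `S_j = ∑_i ‖∂_i Δ̇_j u‖₂²` the block dissipation (`BlockEnergyIdentity.blockL2_sq_toReal_sub_eq`).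
* `sum_ofReal_blockDiss_le`, `sum_eLpNorm_fderiv_sq_eq_lintegral` — bookkeeping: over EVERY finite band the block
  dissipations add up to at most `8 ∫ |∇w|²` (`∂_i Δ̇_j = Δ̇_j ∂_i` and the Littlewood–Paley square-function bound
  `∑_j ‖Δ̇_j v‖₂² ≤ 8 ‖v‖₂²` applied to `v = ∂_i w`).
* `band_flux_le` (**L17 — THE BAND-FLUX CEILING**) — for EVERY finite band `B` and every window `[s, t] ⊂ (0, T)`:
  `∫_s^t Π_B(u) dτ ≤ 8 ‖u(0)‖₂²` — the net energy handed into any band over any window is bounded by the initial energy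
  (stock at `t`: square function + Leray's `‖u(t)‖₂ ≤ ‖u(0)‖₂`; dissipation: square function on the derivatives + the
  energy inequality with the classical gradient, `ν ∫₀ᵀ ∫ |∇u|² ≤ ½ ‖u(0)‖₂²`). Uniform in the band and the window.
* `band_flux_ge_neg_stock` (**THE BACKSCATTER FLOOR**) — `∫_s^t Π_B(u) dτ ≥ −½ ∑_{j∈B} ‖Δ̇_j u(s)‖₂²`: the INVERSE flux out
  of a band over a window never exceeds the band's initial stock; `highBand_flux_ge` — for the band `{q, …, q+N−1}` that
  stock is `≤ 4^{-q} F(u(s))` (`F = ∑_l 4^l ‖Δ̇_l u(s)‖₂² < ∞` at an interior time), so no sustained inverse cascade can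
  come out of the high levels: `∫_s^t Π_{q..q+N−1} ≥ −F(u(s))/(2·4^q)`, uniformly in `N` and `t`.
The pass-on (η) reading of the ceiling against L16′ is `FluxPassOnFloor.pass_on_floor` (next module).

0 sorry; no new definitions, no named facts (inputs: `BlockEnergyIdentity.blockL2_sq_toReal_sub_eq` /
`neg_integral_transfer_ge`, `LevelFluxFloor.four_pow_mul_sum_blockL2_sq_le` / `dyadicF_ne_top`,
`IsLerayHopfOn.lintegral_frobeniusNormSq_fderiv_of_classical`, `tsum_eLpNorm_blockFn_sq_le`).

## References

* A. Cheskidov, P. Constantin, S. Friedlander, R. Shvydkoy, Nonlinearity 21 (2008) 1233–1252 (Littlewood–Paley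
  energy flux). [CCFS2008]
* A. Cheskidov, R. Shvydkoy, Arch. Ration. Mech. Anal. 195 (2010) 159–169, Lemma 3.2 (proof, (8)). [CheskidovShvydkoy2010]
* P. Constantin, Comm. Math. Phys. 129 (1990) 241–266, §2 (2.21) (the energy inequality with the classical gradient).
  [Constantin1990]
-/

noncomputable section

open MeasureTheory Set Function Filter Topology
open scoped ENNReal NNReal RealInnerProductSpace
open Literature.Analysis.FluidPDE Literature.Analysis.FunctionSpaces
open Literature.Analysis.FluidPDE.LPBounds (gradSq)
open Summit.NavierStokesRegularity.FluidComputer.BlockEnergyTransport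
open Summit.NavierStokesRegularity.FluidComputer.BlockEnergyIdentity
open Summit.NavierStokesRegularity.FluidComputer.LevelFluxFloor

namespace Summit.NavierStokesRegularity.FluidComputer.BandFluxCeiling

/-! ## Bookkeeping: the block dissipations of a band against the gradient -/

/-- For a smooth `L²` field `w` and every level `j`: `ofReal (S_j(w)) = ∑_i ‖Δ̇_j ∂_i w‖₂²`, `S_j(w) = ∑_i ∫ ‖∂_i Δ̇_j w‖²`
(the derivative of a block is the block of the derivative). [folklore] -/
theorem ofReal_blockDiss_eq {w : EuclideanSpace ℝ (Fin 3) → EuclideanSpace ℝ (Fin 3)} (hw : IsSmoothL2Field w)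
    (j : ℤ) :
    ENNReal.ofReal (∑ i, ∫ x, ‖fderiv ℝ (blockFn j w) x
        (stdOrthonormalBasis ℝ (EuclideanSpace ℝ (Fin 3)) i)‖ ^ 2) =
      ∑ i, eLpNorm (blockFn j (fun x => fderiv ℝ w x
        (stdOrthonormalBasis ℝ (EuclideanSpace ℝ (Fin 3)) i))) 2 volume ^ 2 := by
  rw [← (toReal_blockL2_sq_eq hw j).2]
  simp only [gradSq]
  refine Finset.sum_congr rfl fun i _ => ?_
  rw [LPBounds.eLpNorm_fderiv_blockFn_eq hw j]

/-- **The block dissipations of a band add up to at most `8 ∫ |∇w|²`**: for a smooth `L²` field `w` and every finite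
set of levels `B`, `∑_{j∈B} ofReal (S_j(w)) ≤ 8 ∑_i ‖∂_i w‖₂²` (square-function bound `∑_j ‖Δ̇_j v‖₂² ≤ 8‖v‖₂²` for
`v = ∂_i w`). [folklore] -/
theorem sum_ofReal_blockDiss_le {w : EuclideanSpace ℝ (Fin 3) → EuclideanSpace ℝ (Fin 3)} (hw : IsSmoothL2Field w)
    (B : Finset ℤ) :
    ∑ j ∈ B, ENNReal.ofReal (∑ i, ∫ x, ‖fderiv ℝ (blockFn j w) x
        (stdOrthonormalBasis ℝ (EuclideanSpace ℝ (Fin 3)) i)‖ ^ 2) ≤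
      8 * ∑ i, eLpNorm (fun x => fderiv ℝ w x
        (stdOrthonormalBasis ℝ (EuclideanSpace ℝ (Fin 3)) i)) 2 volume ^ 2 := by
  simp_rw [ofReal_blockDiss_eq hw]
  rw [Finset.sum_comm, Finset.mul_sum]
  refine Finset.sum_le_sum fun i _ => ?_
  calc ∑ j ∈ B, eLpNorm (blockFn j (fun x => fderiv ℝ w x
          (stdOrthonormalBasis ℝ (EuclideanSpace ℝ (Fin 3)) i))) 2 volume ^ 2
      ≤ ∑' j, eLpNorm (blockFn j (fun x => fderiv ℝ w x
          (stdOrthonormalBasis ℝ (EuclideanSpace ℝ (Fin 3)) i))) 2 volume ^ 2 := ENNReal.sum_le_tsum B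
    _ ≤ 8 * eLpNorm (fun x => fderiv ℝ w x (stdOrthonormalBasis ℝ (EuclideanSpace ℝ (Fin 3)) i)) 2 volume ^ 2 :=
        tsum_eLpNorm_blockFn_sq_le (hw.memLp_fderiv_apply _)

/-- `∑_i ‖∂_i w‖₂² = ∫⁻ ofReal |∇w(x)|²_F` for a smooth `L²` field (the Frobenius norm over the standard basis).
[folklore] -/
theorem sum_eLpNorm_fderiv_sq_eq_lintegral {w : EuclideanSpace ℝ (Fin 3) → EuclideanSpace ℝ (Fin 3)}
    (hw : IsSmoothL2Field w) :
    ∑ i, eLpNorm (fun x => fderiv ℝ w x (stdOrthonormalBasis ℝ (EuclideanSpace ℝ (Fin 3)) i)) 2 volume ^ 2 =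
      ∫⁻ x, ENNReal.ofReal (frobeniusNormSq (fderiv ℝ w x)) := by
  simp_rw [eLpNorm_two_sq_eq_lintegral]
  rw [← lintegral_finsetSum' _ (fun i _ => ((hw.memLp_fderiv_apply _).1.aemeasurable.enorm.pow_const _))]
  refine lintegral_congr fun x => ?_
  rw [frobeniusNormSq, ENNReal.ofReal_sum_of_nonneg (fun i _ => sq_nonneg _)]
  refine Finset.sum_congr rfl fun i _ => ?_
  rw [← ofReal_norm, ENNReal.ofReal_pow (norm_nonneg _)]

/-! ## The signed feeding of one level, and its dissipation in `ℝ≥0∞` form -/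

/-- **The signed balance solved for the feeding.** Along a maximal smooth solution Leray–Hopf from `u 0`, for
`0 < s ≤ t < T` and every level `j`: `−∫_s^t N_j(u(τ)) dτ = ½(‖Δ̇_j u(t)‖₂² − ‖Δ̇_j u(s)‖₂²) + ν ∫_s^t S_j(u(τ)) dτ`.
[cite: CheskidovShvydkoy2010, Lemma 3.2 (proof, (8))] -/
theorem neg_integral_transfer_eq {ν T : ℝ} (hν : 0 < ν) (hT : 0 < T)
    {u : ℝ → EuclideanSpace ℝ (Fin 3) → EuclideanSpace ℝ (Fin 3)} {p : ℝ → EuclideanSpace ℝ (Fin 3) → ℝ}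
    (hmax : IsMaximalSmoothSolution ν 0 u p T) (hLH : IsLerayHopfOn T ν 0 (u 0) u)
    {s t : ℝ} (hs : 0 < s) (hst : s ≤ t) (htT : t < T) (j : ℤ) :
    -(∫ τ in s..t, ∫ x, ⟪blockFn j (u τ) x, blockFn j (convect (u τ) (u τ)) x⟫) =
      ((blockL2 (u t) j ^ 2).toReal - (blockL2 (u s) j ^ 2).toReal) / 2 +
        ν * ∫ τ in s..t, (∑ i, ∫ x, ‖fderiv ℝ (blockFn j (u τ)) x
          (stdOrthonormalBasis ℝ (EuclideanSpace ℝ (Fin 3)) i)‖ ^ 2) := by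
  obtain ⟨hN, hS, hE⟩ := blockL2_sq_toReal_sub_eq hν hT hmax hLH hs hst htT j
  rw [intervalIntegral.integral_sub (hS.const_mul (-ν)) hN, intervalIntegral.integral_const_mul] at hE
  linarith

/-- The windowed block dissipation in `ℝ≥0∞` form: `∫_s^t S_j = (∫⁻_{(s,t]} ofReal S_j).toReal`, the lower integral being
finite and its integrand a.e.-measurable on the window. [folklore] -/
theorem integral_blockDiss_eq_toReal {ν T : ℝ} (hν : 0 < ν) (hT : 0 < T)
    {u : ℝ → EuclideanSpace ℝ (Fin 3) → EuclideanSpace ℝ (Fin 3)} {p : ℝ → EuclideanSpace ℝ (Fin 3) → ℝ}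
    (hmax : IsMaximalSmoothSolution ν 0 u p T) (hLH : IsLerayHopfOn T ν 0 (u 0) u)
    {s t : ℝ} (hs : 0 < s) (hst : s ≤ t) (htT : t < T) (j : ℤ) :
    (∫ τ in s..t, (∑ i, ∫ x, ‖fderiv ℝ (blockFn j (u τ)) x
        (stdOrthonormalBasis ℝ (EuclideanSpace ℝ (Fin 3)) i)‖ ^ 2)) =
      (∫⁻ τ in Ioc s t, ENNReal.ofReal (∑ i, ∫ x, ‖fderiv ℝ (blockFn j (u τ)) x
        (stdOrthonormalBasis ℝ (EuclideanSpace ℝ (Fin 3)) i)‖ ^ 2)).toReal ∧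
    (∫⁻ τ in Ioc s t, ENNReal.ofReal (∑ i, ∫ x, ‖fderiv ℝ (blockFn j (u τ)) x
        (stdOrthonormalBasis ℝ (EuclideanSpace ℝ (Fin 3)) i)‖ ^ 2)) ≠ ∞ ∧
    AEMeasurable (fun τ => ENNReal.ofReal (∑ i, ∫ x, ‖fderiv ℝ (blockFn j (u τ)) x
        (stdOrthonormalBasis ℝ (EuclideanSpace ℝ (Fin 3)) i)‖ ^ 2)) (volume.restrict (Ioc s t)) := by
  obtain ⟨-, hS, -⟩ := blockL2_sq_toReal_sub_eq hν hT hmax hLH hs hst htT j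
  have hint : IntegrableOn (fun τ => ∑ i, ∫ x, ‖fderiv ℝ (blockFn j (u τ)) x
      (stdOrthonormalBasis ℝ (EuclideanSpace ℝ (Fin 3)) i)‖ ^ 2) (Ioc s t) volume := hS.1
  refine ⟨?_, hint.lintegral_lt_top.ne, hint.aestronglyMeasurable.aemeasurable.ennreal_ofReal⟩
  rw [intervalIntegral.integral_of_le hst]
  exact integral_eq_lintegral_of_nonneg_ae
    (ae_of_all _ fun τ => Finset.sum_nonneg fun i _ => integral_nonneg fun x => by positivity)
    hint.aestronglyMeasurable

/-- **The time-integrated dissipation of a maximal smooth Leray–Hopf solution**: with `D = ∫⁻_{(0,T)} ∫⁻ |∇u|²_F`,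
`D < ∞` and `ν · D.toReal ≤ ½ ‖u(0)‖₂²` (the energy inequality with the classical gradient). [cite: Constantin1990, §2 eq. (2.21)] -/
theorem dissipation_le_energy {ν T : ℝ} (hν : 0 < ν) (hT : 0 < T)
    {u : ℝ → EuclideanSpace ℝ (Fin 3) → EuclideanSpace ℝ (Fin 3)} {p : ℝ → EuclideanSpace ℝ (Fin 3) → ℝ}
    (hmax : IsMaximalSmoothSolution ν 0 u p T) (hLH : IsLerayHopfOn T ν 0 (u 0) u) :
    (∫⁻ τ in Ioo 0 T, ∫⁻ x, ENNReal.ofReal (frobeniusNormSq (fderiv ℝ (u τ) x))) ≠ ∞ ∧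
    ν * (∫⁻ τ in Ioo 0 T, ∫⁻ x, ENNReal.ofReal (frobeniusNormSq (fderiv ℝ (u τ) x))).toReal ≤
      (eLpNorm (u 0) 2 volume).toReal ^ 2 / 2 := by
  have _ := hν
  obtain ⟨h1, h2⟩ := IsLerayHopfOn.lintegral_frobeniusNormSq_fderiv_of_classical hmax.1 hLH hT
  refine ⟨h1, h2.trans (le_of_eq ?_)⟩
  rw [kineticEnergy_eq_half_toReal_eLpNorm_sq (hLH.memLp 0 ⟨le_rfl, hT.le⟩)]
  ring

/-! ## L17 — the band-flux ceiling -/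

/-- **L17 — THE BAND-FLUX CEILING.** For every maximal smooth solution `(u, p)` of the unforced Navier–Stokes system on
`ℝ³ × [0, T)` (`ν > 0`) which is Leray–Hopf from `u 0`, all `0 < s ≤ t < T` and EVERY finite set of levels `B`:
`∫_s^t Π_B(u(τ)) dτ = −∑_{j∈B} ∫_s^t N_j(u(τ)) dτ ≤ 8 ‖u(0)‖₂²` — the NET energy handed into any band over any window is
bounded by the initial energy, UNIFORMLY in the band and the window. Proof: the signed balance per level
(`neg_integral_transfer_eq`) summed over the band; the stock at `t` is `≤ ½ ∑_j ‖Δ̇_j u(t)‖₂² ≤ 4‖u(t)‖₂² ≤ 4‖u(0)‖₂²`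
(square function, Leray); the dissipation is `ν ∑_{j∈B} ∫ S_j ≤ 8 ν ∫∫ |∇u|² ≤ 4 ‖u(0)‖₂²` (`∂_i Δ̇_j = Δ̇_j ∂_i`, square
function, the energy inequality with the classical gradient). The companion of L16 (band flux ≥ band rent − band
stock) and L16′ (forward-flux floor). [cite: CheskidovShvydkoy2010, Lemma 3.2 (proof, (8))] -/
theorem band_flux_le {ν T : ℝ} (hν : 0 < ν) (hT : 0 < T)
    {u : ℝ → EuclideanSpace ℝ (Fin 3) → EuclideanSpace ℝ (Fin 3)} {p : ℝ → EuclideanSpace ℝ (Fin 3) → ℝ}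
    (hmax : IsMaximalSmoothSolution ν 0 u p T) (hLH : IsLerayHopfOn T ν 0 (u 0) u)
    {s t : ℝ} (hs : 0 < s) (hst : s ≤ t) (htT : t < T) (B : Finset ℤ) :
    -∑ j ∈ B, (∫ τ in s..t, ∫ x, ⟪blockFn j (u τ) x, blockFn j (convect (u τ) (u τ)) x⟫) ≤
      8 * (eLpNorm (u 0) 2 volume).toReal ^ 2 := by
  classical
  set E : ℝ := (eLpNorm (u 0) 2 volume).toReal with hE
  have hE0 : 0 ≤ E := ENNReal.toReal_nonneg
  have hE₀top : eLpNorm (u 0) 2 volume ≠ ∞ := (hLH.memLp 0 ⟨le_rfl, hT.le⟩).eLpNorm_ne_top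
  have htI : t ∈ Icc 0 T := ⟨hs.le.trans hst, htT.le⟩
  -- Step 1: per level, `-∫N_j = ½Δ_j + ν ∫S_j ≤ ½ a_j(t)² + ν ∫ S_j`
  rw [← Finset.sum_neg_distrib]
  have hlev : ∀ j ∈ B, -(∫ τ in s..t, ∫ x, ⟪blockFn j (u τ) x, blockFn j (convect (u τ) (u τ)) x⟫) ≤
      (blockL2 (u t) j ^ 2).toReal / 2 + ν * (∫⁻ τ in Ioc s t, ENNReal.ofReal (∑ i, ∫ x,
        ‖fderiv ℝ (blockFn j (u τ)) x (stdOrthonormalBasis ℝ (EuclideanSpace ℝ (Fin 3)) i)‖ ^ 2)).toReal := by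
    intro j _
    rw [neg_integral_transfer_eq hν hT hmax hLH hs hst htT j,
      (integral_blockDiss_eq_toReal hν hT hmax hLH hs hst htT j).1]
    have h0 : 0 ≤ (blockL2 (u s) j ^ 2).toReal := ENNReal.toReal_nonneg
    linarith
  refine (Finset.sum_le_sum hlev).trans ?_
  rw [Finset.sum_add_distrib, ← Finset.sum_div, ← Finset.mul_sum]
  -- Step 2: the stock at `t`
  have hfin : ∀ j ∈ B, blockL2 (u t) j ^ 2 ≠ ∞ := fun j _ =>
    ENNReal.pow_ne_top ((isSmoothL2Field_slice_of_maximal hν hT hmax hLH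
      ⟨hs.trans_le hst, htT⟩).blockFn j).memLp_two.eLpNorm_ne_top
  have hstock : ∑ j ∈ B, (blockL2 (u t) j ^ 2).toReal ≤ 8 * E ^ 2 := by
    rw [← ENNReal.toReal_sum hfin]
    have h1 : ∑ j ∈ B, blockL2 (u t) j ^ 2 ≤ 8 * eLpNorm (u 0) 2 volume ^ 2 :=
      calc ∑ j ∈ B, blockL2 (u t) j ^ 2 ≤ ∑' j, blockL2 (u t) j ^ 2 := ENNReal.sum_le_tsum B
        _ ≤ 8 * eLpNorm (u t) 2 volume ^ 2 := tsum_eLpNorm_blockFn_sq_le (hLH.memLp t htI)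
        _ ≤ 8 * eLpNorm (u 0) 2 volume ^ 2 := by
            gcongr
            exact hLH.eLpNorm_le_eLpNorm_datum hν.le (hLH.memLp 0 ⟨le_rfl, hT.le⟩) htI
    have h2 := ENNReal.toReal_mono (ENNReal.mul_ne_top (by norm_num) (ENNReal.pow_ne_top hE₀top)) h1
    rwa [ENNReal.toReal_mul, ENNReal.toReal_pow, ENNReal.toReal_ofNat] at h2
  -- Step 3: the dissipation of the band
  obtain ⟨hDtop, hDle⟩ := dissipation_le_energy hν hT hmax hLH
  set D : ℝ≥0∞ := ∫⁻ τ in Ioo 0 T, ∫⁻ x, ENNReal.ofReal (frobeniusNormSq (fderiv ℝ (u τ) x)) with hD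
  have hdiss : ∑ j ∈ B, (∫⁻ τ in Ioc s t, ENNReal.ofReal (∑ i, ∫ x,
      ‖fderiv ℝ (blockFn j (u τ)) x (stdOrthonormalBasis ℝ (EuclideanSpace ℝ (Fin 3)) i)‖ ^ 2)).toReal ≤
      8 * D.toReal := by
    rw [← ENNReal.toReal_sum fun j _ => (integral_blockDiss_eq_toReal hν hT hmax hLH hs hst htT j).2.1,
      ← lintegral_finsetSum' _ fun j _ => (integral_blockDiss_eq_toReal hν hT hmax hLH hs hst htT j).2.2]
    have h1 : ∫⁻ τ in Ioc s t, ∑ j ∈ B, ENNReal.ofReal (∑ i, ∫ x,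
        ‖fderiv ℝ (blockFn j (u τ)) x (stdOrthonormalBasis ℝ (EuclideanSpace ℝ (Fin 3)) i)‖ ^ 2) ≤ 8 * D := by
      calc ∫⁻ τ in Ioc s t, ∑ j ∈ B, ENNReal.ofReal (∑ i, ∫ x,
            ‖fderiv ℝ (blockFn j (u τ)) x (stdOrthonormalBasis ℝ (EuclideanSpace ℝ (Fin 3)) i)‖ ^ 2)
          ≤ ∫⁻ τ in Ioc s t, 8 * ∫⁻ x, ENNReal.ofReal (frobeniusNormSq (fderiv ℝ (u τ) x)) := by
            refine setLIntegral_mono' measurableSet_Ioc fun τ hτ => ?_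
            have hw : IsSmoothL2Field (u τ) :=
              isSmoothL2Field_slice_of_maximal hν hT hmax hLH ⟨hs.trans hτ.1, hτ.2.trans_lt htT⟩
            rw [← sum_eLpNorm_fderiv_sq_eq_lintegral hw]
            exact sum_ofReal_blockDiss_le hw B
        _ = 8 * ∫⁻ τ in Ioc s t, ∫⁻ x, ENNReal.ofReal (frobeniusNormSq (fderiv ℝ (u τ) x)) :=
            lintegral_const_mul' _ _ (by norm_num)
        _ ≤ 8 * D := by
            gcongr
            exact lintegral_mono_set fun τ hτ => ⟨hs.trans hτ.1, hτ.2.trans_lt htT⟩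
    have h2 := ENNReal.toReal_mono (ENNReal.mul_ne_top (by norm_num) hDtop) h1
    rwa [ENNReal.toReal_mul, ENNReal.toReal_ofNat] at h2
  -- Step 4: assemble
  have hνD : ν * (8 * D.toReal) ≤ 4 * E ^ 2 := by nlinarith [hDle]
  calc (∑ j ∈ B, (blockL2 (u t) j ^ 2).toReal) / 2 +
        ν * ∑ j ∈ B, (∫⁻ τ in Ioc s t, ENNReal.ofReal (∑ i, ∫ x,
          ‖fderiv ℝ (blockFn j (u τ)) x (stdOrthonormalBasis ℝ (EuclideanSpace ℝ (Fin 3)) i)‖ ^ 2)).toReal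
      ≤ 8 * E ^ 2 / 2 + ν * (8 * D.toReal) := by gcongr
    _ ≤ 8 * E ^ 2 := by linarith

/-! ## The backscatter floor -/

/-- **THE BACKSCATTER FLOOR.** Along every maximal smooth solution Leray–Hopf from `u 0`, for `0 < s ≤ t < T` and every
finite set of levels `B`: `∫_s^t Π_B(u) dτ ≥ −½ ∑_{j∈B} ‖Δ̇_j u(s)‖₂²` — the INVERSE (backward) flux out of a band over a
window never exceeds the band's initial stock (the band's energy can at most be returned; dissipation only helps).
[cite: CheskidovShvydkoy2010, Lemma 3.2 (proof, (8))] -/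
theorem band_flux_ge_neg_stock {ν T : ℝ} (hν : 0 < ν) (hT : 0 < T)
    {u : ℝ → EuclideanSpace ℝ (Fin 3) → EuclideanSpace ℝ (Fin 3)} {p : ℝ → EuclideanSpace ℝ (Fin 3) → ℝ}
    (hmax : IsMaximalSmoothSolution ν 0 u p T) (hLH : IsLerayHopfOn T ν 0 (u 0) u)
    {s t : ℝ} (hs : 0 < s) (hst : s ≤ t) (htT : t < T) (B : Finset ℤ) :
    -(∑ j ∈ B, (blockL2 (u s) j ^ 2).toReal) / 2 ≤
      -∑ j ∈ B, (∫ τ in s..t, ∫ x, ⟪blockFn j (u τ) x, blockFn j (convect (u τ) (u τ)) x⟫) := by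
  have key : ∀ j ∈ B, -(blockL2 (u s) j ^ 2).toReal / 2 ≤
      -(∫ τ in s..t, ∫ x, ⟪blockFn j (u τ) x, blockFn j (convect (u τ) (u τ)) x⟫) := by
    intro j _
    obtain ⟨h1, -⟩ := neg_integral_transfer_ge hν hT hmax hLH hs hst htT j
    have hS0 : 0 ≤ ∫ τ in s..t, (∑ i, ∫ x, ‖fderiv ℝ (blockFn j (u τ)) x
        (stdOrthonormalBasis ℝ (EuclideanSpace ℝ (Fin 3)) i)‖ ^ 2) :=
      intervalIntegral.integral_nonneg hst fun τ _ =>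
        Finset.sum_nonneg fun i _ => integral_nonneg fun x => by positivity
    nlinarith [mul_nonneg hν.le hS0]
  calc -(∑ j ∈ B, (blockL2 (u s) j ^ 2).toReal) / 2 = ∑ j ∈ B, -(blockL2 (u s) j ^ 2).toReal / 2 := by
        rw [← Finset.sum_div, Finset.sum_neg_distrib]
    _ ≤ ∑ j ∈ B, -(∫ τ in s..t, ∫ x, ⟪blockFn j (u τ) x, blockFn j (convect (u τ) (u τ)) x⟫) :=
        Finset.sum_le_sum key
    _ = -∑ j ∈ B, (∫ τ in s..t, ∫ x, ⟪blockFn j (u τ) x, blockFn j (convect (u τ) (u τ)) x⟫) :=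
        Finset.sum_neg_distrib _

/-- **NO SUSTAINED INVERSE CASCADE OUT OF THE HIGH LEVELS.** For the band `{q, …, q+N−1}` the initial stock is at most
`4^{-q} F(u(s))`, `F(w) = ∑_l 4^l ‖Δ̇_l w‖₂²` (finite at every interior time), hence
`∫_s^t Π_{q..q+N−1}(u) dτ ≥ −F(u(s)) / (2 · 4^q)` — uniformly in the band length `N` and the window end `t`.
[cite: CheskidovShvydkoy2010, Lemma 3.2 (proof, (8))] -/
theorem highBand_flux_ge {ν T : ℝ} (hν : 0 < ν) (hT : 0 < T)
    {u : ℝ → EuclideanSpace ℝ (Fin 3) → EuclideanSpace ℝ (Fin 3)} {p : ℝ → EuclideanSpace ℝ (Fin 3) → ℝ}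
    (hmax : IsMaximalSmoothSolution ν 0 u p T) (hLH : IsLerayHopfOn T ν 0 (u 0) u)
    {s t : ℝ} (hs : 0 < s) (hst : s ≤ t) (htT : t < T) (q N : ℕ) :
    -(dyadicF (u s)).toReal / (2 * (4 : ℝ) ^ q) ≤
      -∑ k ∈ Finset.range N, (∫ τ in s..t,
        ∫ x, ⟪blockFn ((q + k : ℕ) : ℤ) (u τ) x, blockFn ((q + k : ℕ) : ℤ) (convect (u τ) (u τ)) x⟫) := by
  classical
  have hsI : s ∈ Ioo 0 T := ⟨hs, hst.trans_lt htT⟩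
  have hFtop : dyadicF (u s) ≠ ∞ := dyadicF_ne_top (isSmoothL2Field_slice_of_maximal hν hT hmax hLH hsI)
  -- the backscatter floor on the band, written over `k < N`
  set B : Finset ℤ := (Finset.range N).image (fun k : ℕ => ((q + k : ℕ) : ℤ)) with hB
  have hinj : ∀ a ∈ Finset.range N, ∀ b ∈ Finset.range N,
      ((q + a : ℕ) : ℤ) = ((q + b : ℕ) : ℤ) → a = b := fun a _ b _ h => by simpa using h
  have h := band_flux_ge_neg_stock hν hT hmax hLH hs hst htT B
  rw [hB, Finset.sum_image hinj, Finset.sum_image hinj] at h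
  refine le_trans ?_ h
  -- the stock of the band: `4^q St ≤ F`
  set St : ℝ := ∑ k ∈ Finset.range N, (blockL2 (u s) ((q + k : ℕ) : ℤ) ^ 2).toReal with hSt
  have hSt0 : 0 ≤ St := Finset.sum_nonneg fun k _ => ENNReal.toReal_nonneg
  have hstock : (4 : ℝ) ^ q * St ≤ (dyadicF (u s)).toReal := by
    have h1 := four_pow_mul_sum_blockL2_sq_le (u s) q N
    have hfin : ∀ k ∈ Finset.range N, blockL2 (u s) ((q + k : ℕ) : ℤ) ^ 2 ≠ ∞ := fun k _ =>
      ENNReal.pow_ne_top (((isSmoothL2Field_slice_of_maximal hν hT hmax hLH hsI).blockFn _).memLp_two.eLpNorm_ne_top)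
    have h2 := ENNReal.toReal_mono hFtop h1
    rw [ENNReal.toReal_mul, ENNReal.toReal_sum hfin, ENNReal.toReal_pow, ENNReal.toReal_ofNat, pow_mul] at h2
    have hP2 : ((2 : ℝ) ^ 2) ^ q = (4 : ℝ) ^ q := by norm_num
    rw [hP2] at h2
    exact h2
  have h4 : 0 < (4 : ℝ) ^ q := by positivity
  rw [div_le_iff₀ (by positivity), show -St / 2 * (2 * (4 : ℝ) ^ q) = -((4 : ℝ) ^ q * St) by ring]
  linarith

end Summit.NavierStokesRegularity.FluidComputer.BandFluxCeiling

end
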